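import Literature.MathematicalPhysics.QuantumFieldTheory.Balaban1983to89.StrongCouplingOpenWindow

/-!
# Strong coupling, temporal axial gauge on the open-time slab — frozen plaquette-system energies (part 1 of 5)

**observatory of the non-perturbative crossover; no mass-gap claim.**  Cell `pub-balaban`, build IR-3 v2
(two-front crossover ledger), IR-SC lineage, generation 13.  Part 1 of the SC-c door by COMPLETE TEMPORAL AXIAL GAUGE on
the open-time slab (parts 2–5: `StrongCouplingFrozenPlaqKR`, `StrongCouplingSlabAxialGauge`, `StrongCouplingSlabAxialRows`,
`StrongCouplingSlabAxialClustering` with the door itself).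

THE MECHANISM (this part, abstract).  For a plaquette system `S : PlaqSystem V P` (the tree's
`StrongCouplingOpenWindow.PlaqSystem`) and a finite set `F` of links, the FROZEN ENERGY `E^F_w(U) := E_w(freeze_F U)`
reads the energy on the configuration frozen to `1` on `F`.  Its weight specification `weightSpec E^F_w` (Georgii 2011,
Def. 2.9, a priori measure Haar at every link) has Haar one-link laws on `F` and the original one-link laws at the frozen
boundary condition off `F` (part 2); here:
* §1 `freezeOn F U`, its interaction with `Function.update` and `glueWith`, continuity and measurability;
* §2 `frozenEnergy S F w`, continuity, measurability, boundedness;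
* §3 locality (`dependsOn_specAvg_frozen`) and the one-link Lipschitz bound (`isLipBound_specAvg_frozen`, Georgii 2011
  Prop. 8.8 in metric form) of the smoothing `γ_Λ f` by the frozen weight specification — the tree's
  `dependsOn_specAvg_weightSpec` / `isLipBound_specAvg_weightSpec` read on frozen configurations (a frozen link does not
  move the energy at all, so the constants are the tree's).

Every statement is kernel-checked; nothing here moves any number of the ledger; no statement of the manuscripts under
audit is used.  References (specification framework only): [cite: Georgii2011, Def. 2.9, Prop. 8.8].
-/

noncomputable section

open MeasureTheory ProbabilityTheory Filter Function Finset
open Literature.Probability.LatticeModels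
open Literature.Probability.LatticeModels.DobrushinMetric
open Literature.MathematicalPhysics.QuantumFieldTheory
open Literature.MathematicalPhysics.QuantumFieldTheory.Balaban1983to89
open Literature.MathematicalPhysics.QuantumFieldTheory.Balaban1983to89.StrongCouplingDobrushinWindow
open Literature.MathematicalPhysics.QuantumFieldTheory.Balaban1983to89.StrongCouplingTorusWindow
open Literature.MathematicalPhysics.QuantumFieldTheory.Balaban1983to89.StrongCouplingOpenWindow

namespace Summit.QuantumFields.BalabanUV.InfraRed.StrongCouplingFrozenPlaqSpec

/-! ### §1 Freezing a configuration on a set of links -/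

section Freeze

variable {V : Type*} [DecidableEq V] {G : Type*} [Group G] (F : Finset V)

/-- **Freezing on `F`**: set the variables of the links of `F` to the identity and keep the others. [folklore] -/
def freezeOn (σ : V → G) : V → G := fun v => if v ∈ F then 1 else σ v

/-- A frozen link carries the identity. [folklore] -/
@[simp] theorem freezeOn_of_mem {v : V} (hv : v ∈ F) (σ : V → G) : freezeOn F σ v = 1 := by
  simp [freezeOn, hv]

/-- An unfrozen link keeps its variable. [folklore] -/
@[simp] theorem freezeOn_of_not_mem {v : V} (hv : v ∉ F) (σ : V → G) : freezeOn F σ v = σ v := by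
  simp [freezeOn, hv]

/-- Freezing only reads the unfrozen links. [folklore] -/
theorem freezeOn_congr {σ τ : V → G} (h : ∀ z, z ∉ F → σ z = τ z) : freezeOn F σ = freezeOn F τ := by
  funext z
  by_cases hz : z ∈ F
  · rw [freezeOn_of_mem F hz, freezeOn_of_mem F hz]
  · rw [freezeOn_of_not_mem F hz, freezeOn_of_not_mem F hz, h z hz]

/-- Two configurations frozen on `F` agree at a link iff they agree there or the link is frozen. [folklore] -/
theorem freezeOn_apply_congr {σ τ : V → G} {z : V} (h : z ∉ F → σ z = τ z) : freezeOn F σ z = freezeOn F τ z := by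
  by_cases hz : z ∈ F
  · rw [freezeOn_of_mem F hz, freezeOn_of_mem F hz]
  · rw [freezeOn_of_not_mem F hz, freezeOn_of_not_mem F hz, h hz]

/-- Updating a frozen link is invisible after freezing. [folklore] -/
theorem freezeOn_update_of_mem {v : V} (hv : v ∈ F) (σ : V → G) (g : G) :
    freezeOn F (Function.update σ v g) = freezeOn F σ :=
  freezeOn_congr F fun z hz => by
    rw [Function.update_of_ne]
    rintro rfl
    exact hz hv

/-- Updating an unfrozen link commutes with freezing. [folklore] -/
theorem freezeOn_update_of_not_mem {v : V} (hv : v ∉ F) (σ : V → G) (g : G) :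
    freezeOn F (Function.update σ v g) = Function.update (freezeOn F σ) v g := by
  funext z
  by_cases hz : z = v
  · subst hz
    rw [freezeOn_of_not_mem F hv, Function.update_self, Function.update_self]
  · rw [Function.update_of_ne hz]
    by_cases hzF : z ∈ F
    · rw [freezeOn_of_mem F hzF, freezeOn_of_mem F hzF]
    · rw [freezeOn_of_not_mem F hzF, freezeOn_of_not_mem F hzF, Function.update_of_ne hz]

/-- Freezing a glued configuration: freeze the inside datum on `F ∩ Λ` and the outside configuration. [folklore] -/
theorem freezeOn_glueWith (Λ : Finset V) (ζ : ↥Λ → G) (σ : V → G) :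
    freezeOn F (glueWith Λ ζ σ) = glueWith Λ (fun z => if (z : V) ∈ F then 1 else ζ z) (freezeOn F σ) := by
  funext z
  by_cases hzΛ : z ∈ Λ <;> by_cases hzF : z ∈ F <;> simp [freezeOn, glueWith, hzΛ, hzF]

/-- Freezing is continuous. [folklore] -/
theorem continuous_freezeOn [TopologicalSpace G] : Continuous (freezeOn (G := G) F) := by
  refine continuous_pi fun v => ?_
  by_cases hv : v ∈ F
  · simp only [freezeOn, hv, if_true]
    exact continuous_const
  · simp only [freezeOn, hv, if_false]
    exact continuous_apply v

/-- Freezing is measurable. [folklore] -/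
@[fun_prop]
theorem measurable_freezeOn [MeasurableSpace G] : Measurable (freezeOn (G := G) F) := by
  refine measurable_pi_lambda _ fun v => ?_
  by_cases hv : v ∈ F
  · simp only [freezeOn, hv, if_true]
    exact measurable_const
  · simp only [freezeOn, hv, if_false]
    exact measurable_pi_apply v

end Freeze

/-! ### §2 The frozen energy of a plaquette system -/

section Energy

variable {V P : Type*} [Fintype P] [DecidableEq V] (S : PlaqSystem V P) {G : Type*} [Group G] (F : Finset V)

/-- The **frozen energy** `E^F_w(U) = E_w(freeze_F U) = ∑_q coef q · w((freeze_F U)_q)` of the plaquette system with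
plaquette log-weight `w`, read on the configuration frozen on `F`. [folklore] -/
def frozenEnergy (w : G → ℝ) (σ : V → G) : ℝ :=
  S.energy w (freezeOn F σ)

/-- Unfolding the frozen energy. [folklore] -/
theorem frozenEnergy_apply (w : G → ℝ) (σ : V → G) : frozenEnergy S F w σ = S.energy w (freezeOn F σ) := rfl

/-- Updating a frozen link does not move the frozen energy. [folklore] -/
theorem frozenEnergy_update_of_mem (w : G → ℝ) {v : V} (hv : v ∈ F) (σ : V → G) (g : G) :
    frozenEnergy S F w (Function.update σ v g) = frozenEnergy S F w σ := by
  rw [frozenEnergy, frozenEnergy, freezeOn_update_of_mem F hv]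

/-- Updating an unfrozen link updates the frozen configuration. [folklore] -/
theorem frozenEnergy_update_of_not_mem (w : G → ℝ) {v : V} (hv : v ∉ F) (σ : V → G) (g : G) :
    frozenEnergy S F w (Function.update σ v g) = S.energy w (Function.update (freezeOn F σ) v g) := by
  rw [frozenEnergy, freezeOn_update_of_not_mem F hv]

variable [TopologicalSpace G] [IsTopologicalGroup G]

/-- The frozen energy of a continuous log-weight is continuous. [folklore] -/
theorem continuous_frozenEnergy {w : G → ℝ} (hw : Continuous w) : Continuous (frozenEnergy S F w) :=
  (S.continuous_energy hw).comp (continuous_freezeOn F)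

/-- The frozen energy of a continuous log-weight is bounded (compact group). [folklore] -/
theorem exists_abs_frozenEnergy_le [CompactSpace G] {w : G → ℝ} (hw : Continuous w) :
    ∃ C, ∀ σ : V → G, |frozenEnergy S F w σ| ≤ C := by
  obtain ⟨C, hC⟩ := exists_abs_le_of_continuous (S.continuous_energy (G := G) hw)
  exact ⟨C, fun σ => hC _⟩

/-- The frozen energy of a continuous log-weight is measurable. [folklore] -/
@[fun_prop]
theorem measurable_frozenEnergy [Fintype V] [MeasurableSpace G] [BorelSpace G] [SecondCountableTopology G]
    {w : G → ℝ} (hw : Continuous w) : Measurable (frozenEnergy S F w) :=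
  (S.measurable_energy hw).comp (measurable_freezeOn F)

end Energy

/-! ### §3 Smoothing by the frozen weight specification: locality and Lipschitz bounds -/

section Smoothing

variable {V P : Type*} [Fintype V] [Fintype P] [DecidableEq V] (S : PlaqSystem V P) {G : Type*} [Group G]
  [TopologicalSpace G] [IsTopologicalGroup G] [CompactSpace G] [MeasurableSpace G] [BorelSpace G]
  [SecondCountableTopology G] (F : Finset V)

omit [Fintype V] [TopologicalSpace G] [IsTopologicalGroup G] [CompactSpace G] [MeasurableSpace G] [BorelSpace G]
  [SecondCountableTopology G] in
/-- **Quasilocality of the frozen energy shift**: if two outside configurations agree on the plaquette closure of `Λ`,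
the frozen energies of the glued configurations differ by a constant independent of the inside data. [folklore] -/
theorem exists_frozenEnergy_glueWith_eq_add (w : G → ℝ) (Λ : Finset V) {σ τ : V → G}
    (h : ∀ z ∈ S.closure Λ, σ z = τ z) :
    ∃ κ : ℝ, ∀ ζ : ↥Λ → G, frozenEnergy S F w (glueWith Λ ζ σ) = κ + frozenEnergy S F w (glueWith Λ ζ τ) := by
  obtain ⟨κ, hκ⟩ := S.exists_energy_glueWith_eq_add w Λ (σ := freezeOn F σ) (τ := freezeOn F τ) fun z hz =>
    freezeOn_apply_congr F fun _ => h z hz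
  refine ⟨κ, fun ζ => ?_⟩
  rw [frozenEnergy, frozenEnergy, freezeOn_glueWith, freezeOn_glueWith]
  exact hκ _

omit [Fintype V] [TopologicalSpace G] [IsTopologicalGroup G] [CompactSpace G] [MeasurableSpace G] [BorelSpace G]
  [SecondCountableTopology G] in
/-- **One-link Lipschitz bound for the glued frozen energy**: as the tree's `abs_energy_glueWith_sub_le`, the energy
being read on frozen configurations (a frozen link `y` does not move the frozen energy at all). [folklore] -/
theorem abs_frozenEnergy_glueWith_sub_le {w : G → ℝ} {r : G → G → ℝ} {ℓ : ℝ} (hℓ : 0 ≤ ℓ)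
    (hr0 : ∀ a b, 0 ≤ r a b)
    (hwLip : ∀ (q : P) (k : Fin 4) (U U' : V → G), (∀ z, z ≠ S.lk q k → U z = U' z) →
      |w (S.hol U q) - w (S.hol U' q)| ≤ ℓ * r (U (S.lk q k)) (U' (S.lk q k)))
    (Λ : Finset V) {y : V} (hy : y ∉ Λ) {σ τ : V → G} (hστ : ∀ z, z ≠ y → σ z = τ z) (ζ : ↥Λ → G) :
    |frozenEnergy S F w (glueWith Λ ζ σ) - frozenEnergy S F w (glueWith Λ ζ τ)| ≤
      S.wdeg y * (ℓ * r (σ y) (τ y)) := by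
  rw [frozenEnergy, frozenEnergy, freezeOn_glueWith, freezeOn_glueWith]
  have hστ' : ∀ z, z ≠ y → freezeOn F σ z = freezeOn F τ z := fun z hz =>
    freezeOn_apply_congr F fun _ => hστ z hz
  by_cases hyF : y ∈ F
  · have heq : freezeOn F σ = freezeOn F τ :=
      freezeOn_congr F fun z hz => hστ z fun hzy => hz (hzy ▸ hyF)
    rw [heq, sub_self, abs_zero]
    exact mul_nonneg (S.wdeg_nonneg y) (mul_nonneg hℓ (hr0 _ _))
  · have h := S.abs_energy_glueWith_sub_le hwLip Λ hy hστ' (fun z => if (z : V) ∈ F then 1 else ζ z)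
    rwa [freezeOn_of_not_mem F hyF, freezeOn_of_not_mem F hyF] at h

/-- **The frozen smoothing of an observable measurable inside `Λ` depends only on the plaquette closure of `Λ`.**
[folklore] -/
theorem dependsOn_specAvg_frozen {w : G → ℝ} (hw : Continuous w) (Λ : Finset V) {f : (V → G) → ℝ}
    (hfm : Measurable f) (hfdep : DependsOn f (↑Λ : Set V)) :
    DependsOn (specAvg (weightSpec (frozenEnergy S F w)) Λ f) (↑(S.closure Λ) : Set V) := by
  intro σ τ h
  obtain ⟨κ, hκ⟩ := exists_frozenEnergy_glueWith_eq_add S F w Λ (σ := σ) (τ := τ) fun z hz => h z hz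
  have hEm := measurable_frozenEnergy S F (G := G) hw
  rw [specAvg_weightSpec_eq hEm Λ hfm σ, specAvg_weightSpec_eq hEm Λ hfm τ]
  have hint : ∀ ζ : ↥Λ → G, f (glueWith Λ ζ σ) = f (glueWith Λ ζ τ) := fun ζ => hfdep fun z hz => by
    rw [glueWith_apply_mem _ _ _ hz, glueWith_apply_mem _ _ _ hz]
  simp_rw [hint, hκ]
  rw [tilted_const_add_eq]

/-- **The frozen smoothing is Lipschitz in every outside link** (Georgii 2011, Prop. 8.8: oscillation of a tilt, in metric
form): if the plaquette log-weight is `ℓ`-Lipschitz in each link for a distance `r ≤ D` and the weighted degrees are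
`≤ Dg`, then for `f` measurable inside `Λ` with `|f| ≤ M`, `|γ^F_Λ f(σ) − γ^F_Λ f(τ)| ≤ M (e^{2 Dg ℓ D} − 1)/D · r(σ_y, τ_y)`
whenever `σ = τ` off `y` — the constant of the tree's `isLipBound_specAvg_weightSpec`. [cite: Georgii2011, Prop. 8.8] -/
theorem isLipBound_specAvg_frozen {w : G → ℝ} (hw : Continuous w) {r : G → G → ℝ} (hr0 : ∀ a b, 0 ≤ r a b)
    {D : ℝ} (hD : 0 < D) (hrD : ∀ a b, r a b ≤ D) {ℓ : ℝ} (hℓ : 0 ≤ ℓ)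
    (hwLip : ∀ (q : P) (k : Fin 4) (U U' : V → G), (∀ z, z ≠ S.lk q k → U z = U' z) →
      |w (S.hol U q) - w (S.hol U' q)| ≤ ℓ * r (U (S.lk q k)) (U' (S.lk q k)))
    {Dg : ℝ} (hDg : 0 ≤ Dg) (hdeg : ∀ v, S.wdeg v ≤ Dg)
    (Λ : Finset V) {f : (V → G) → ℝ} (hfm : Measurable f) (hfdep : DependsOn f (↑Λ : Set V)) {M : ℝ}
    (hM : ∀ σ, |f σ| ≤ M) :
    IsLipBound r (specAvg (weightSpec (frozenEnergy S F w)) Λ f)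
      fun _ => M * ((Real.exp (D * (2 * (Dg * ℓ))) - 1) / D) := by
  have hM0 : 0 ≤ M := (abs_nonneg _).trans (hM fun _ => 1)
  set a : ℝ := 2 * (Dg * ℓ) with ha
  have ha0 : 0 ≤ a := by positivity
  have hE0 : 0 ≤ (Real.exp (D * a) - 1) / D :=
    div_nonneg (sub_nonneg.2 (Real.one_le_exp (by positivity))) hD.le
  have hEm := measurable_frozenEnergy S F (G := G) hw
  refine ⟨fun _ => mul_nonneg hM0 hE0, fun y σ τ hστ => ?_⟩
  by_cases hy : y ∈ Λ
  · have hglue : ∀ ζ : ↥Λ → G, glueWith Λ ζ σ = glueWith Λ ζ τ := fun ζ => funext fun z => by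
      by_cases hzΛ : z ∈ Λ
      · rw [glueWith_apply_mem _ _ _ hzΛ, glueWith_apply_mem _ _ _ hzΛ]
      · rw [glueWith_apply_not_mem _ _ _ hzΛ, glueWith_apply_not_mem _ _ _ hzΛ,
          hστ z (by rintro rfl; exact hzΛ hy)]
    rw [specAvg_weightSpec_eq hEm Λ hfm σ, specAvg_weightSpec_eq hEm Λ hfm τ]
    simp_rw [hglue]
    rw [sub_self, abs_zero]
    exact mul_nonneg (mul_nonneg hM0 hE0) (hr0 _ _)
  · rw [specAvg_weightSpec_eq hEm Λ hfm σ, specAvg_weightSpec_eq hEm Λ hfm τ]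
    have hint : ∀ ζ : ↥Λ → G, f (glueWith Λ ζ τ) = f (glueWith Λ ζ σ) := fun ζ => hfdep fun z hz => by
      rw [glueWith_apply_mem _ _ _ hz, glueWith_apply_mem _ _ _ hz]
    simp_rw [hint]
    have h1m : Measurable fun ζ : ↥Λ → G => frozenEnergy S F w (glueWith Λ ζ σ) :=
      hEm.comp (measurable_glueWith Λ σ)
    have h2m : Measurable fun ζ : ↥Λ → G => frozenEnergy S F w (glueWith Λ ζ τ) :=
      hEm.comp (measurable_glueWith Λ τ)
    obtain ⟨B, hB⟩ := exists_abs_frozenEnergy_le S F (G := G) hw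
    have hφm : Measurable fun ζ : ↥Λ → G => f (glueWith Λ ζ σ) := hfm.comp (measurable_glueWith Λ σ)
    have hφL : ∀ a' b' : ↥Λ → G, |f (glueWith Λ a' σ) - f (glueWith Λ b' σ)| ≤ 2 * M := fun a' b' =>
      calc |f (glueWith Λ a' σ) - f (glueWith Λ b' σ)| ≤ |f (glueWith Λ a' σ)| + |f (glueWith Λ b' σ)| := abs_sub _ _
        _ ≤ M + M := add_le_add (hM _) (hM _)
        _ = 2 * M := by ring
    have hε : ∀ ζ : ↥Λ → G, |frozenEnergy S F w (glueWith Λ ζ σ) - frozenEnergy S F w (glueWith Λ ζ τ) - 0| ≤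
        Dg * (ℓ * r (σ y) (τ y)) := fun ζ => by
      rw [sub_zero]
      exact (abs_frozenEnergy_glueWith_sub_le S F hℓ hr0 hwLip Λ hy hστ ζ).trans
        (mul_le_mul_of_nonneg_right (hdeg y) (mul_nonneg hℓ (hr0 _ _)))
    have key := abs_integral_tilted_sub_integral_tilted_le (Measure.pi fun _ : ↥Λ => haarProbability G) h1m h2m
      ⟨B, fun ζ => hB _⟩ ⟨B, fun ζ => hB _⟩ (κ := 0) (ε := Dg * (ℓ * r (σ y) (τ y))) hε hφm ⟨M, fun ζ => hM _⟩ hφL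
    refine key.trans ?_
    have hconv := exp_mul_sub_one_le_div_mul (k := r (σ y) (τ y)) (K := D) (t := a) (hr0 _ _) (hrD _ _) hD ha0
    have e1 : 2 * (Dg * (ℓ * r (σ y) (τ y))) = r (σ y) (τ y) * a := by rw [ha]; ring
    rw [e1]
    calc (Real.exp (r (σ y) (τ y) * a) - 1) / 2 * (2 * M) = M * (Real.exp (r (σ y) (τ y) * a) - 1) := by ring
      _ ≤ M * (r (σ y) (τ y) / D * (Real.exp (D * a) - 1)) := mul_le_mul_of_nonneg_left hconv hM0
      _ = M * ((Real.exp (D * a) - 1) / D) * r (σ y) (τ y) := by ring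

end Smoothing

end Summit.QuantumFields.BalabanUV.InfraRed.StrongCouplingFrozenPlaqSpec
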